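import Summits.AtomisticToContinuum.Crystallization.Theorems.SquareWellLayerCakeGapTwelveToBarlowCombinatorialLayeringTransferTables

/-!
# Combinatorial layering (B1a of `GapTwelveToBarlow`): the chart transfer lemma

Crux `SquareWellLayerCake.GapTwelveToBarlow` (stmt-AtomisticToContinuum-15807), line `Sketch`,
stub `stub_combinatorialLayering`.  The tree's transport machinery
(`PalmUnimodularRigidityShellsToBarlowChartTransport*`) has exactly one two-shell metric input,
`sqNormInt_transfer`: for two BONDED charted sites `j ~ j'` and two sites of their common closed
star, the squared label distance read at `j` equals the one read at `j'`.  Here it is re-proved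
for the COMBINATORIAL integer charts of `…CombinatorialLayeringCharts` (`T = 3 • fccTab` or
`hcpTab`, `e : Fin 12 → Fin N` onto the neighbours, `dist ≤ 1 ↔ sqNormInt (T a - T b) = 18`)
from the local `131/100` dichotomy, the Good separation and ONE closed five-point lemma of metric
geometry taken as a typed hypothesis `(H_lens)`: for a bonded pair `x ~ y` and three common
neighbours `a, b, c` (all nine distances in `[55/57, 1]`) with `a ~ b`, the cross distances
`|ac|`, `|bc|` cannot both lie in `[131/100, √(4 − (131/100)²)]` (numerically infeasible with
uniform margin `0.0169`).  Route: only pairs of COMMON NEIGHBOURS matter; their labels lie in the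
vertex figure of the pole, at squared distance `18, 36, 48, 54` (`transferTable_figure`); `18` is
a bond; `48` is read iff a third common neighbour is bonded to both (`transferTable_48`,
`third_transfer`); a `36`-pair spans a link square whose fourth vertex is not bonded to the other
centre, so it is metrically short (`bounds_of_sq36`), and a `54`-pair has a bonded partner
forming a `36`-pair with its other end (`transferTable_54`), so a `36/54` mismatch is the
configuration excluded by `(H_lens)` (`transfer_key`).  Anchor: `transfer_of_zcharts`.
Tables and the quadrilateral inequality: `…CombinatorialLayeringTransferTables`; plus
`sqNormInt_sub_comm` of the tree's chart file.  Nothing is defined.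
-/

namespace Summit.AtomisticToContinuum.Crystallization.Theorems.SquareWellLayerCakeGapTwelveToBarlow

open Literature.Geometry.DiscreteGeometry
open Summit.AtomisticToContinuum.Crystallization.Theorems.PalmUnimodularRigidityShellsToBarlowChart
  (sqNormInt_sub_comm)

/-! ## The common-neighbour bookkeeping of two integer charts

Throughout, an integer chart at `j` is the conjunction
`(T = 3 • fccTab ∨ T = hcpTab) ∧ e injective ∧ (∀ a, e a ≠ j ∧ dist (x j) (x (e a)) ≤ 1) ∧
(every neighbour of j is some e a) ∧ (∀ a ≠ b, dist (x (e a)) (x (e b)) ≤ 1 ↔ |T a − T b|² = 18)`. -/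

/-- **A `36`-pair is metrically short.**  If the labels `t, t'` of two common neighbours of the
bonded pair `(j, j')` (pole `p`, `e p = j'`) are at squared distance `36` in the chart of `j`,
then `131/100 ≤ |x (e t) − x (e t')|` and `|x (e t) − x (e t')|² + (131/100)² ≤ 4`: the pair is
not bonded (dichotomy at `j`), and the fourth vertex of its link square is a neighbour of `j`
not bonded to `j'`, hence `≥ 131/100` from `x j'` (dichotomy at `j`), and the quadrilateral
inequality applies. [folklore] -/
theorem bounds_of_sq36 {N : ℕ} (x : Fin N → EuclideanSpace ℝ (Fin 3)) (j j' : Fin N)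
    (hgap : ∀ l l' : Fin N, dist (x j) (x l) ≤ 1 → dist (x j) (x l') ≤ 1 →
      1 < dist (x l) (x l') → (131 : ℝ) / 100 ≤ dist (x l) (x l'))
    (hb : dist (x j) (x j') ≤ 1)
    {T : Fin 12 → Fin 3 → ℤ} {e : Fin 12 → Fin N}
    (hc : ((T = fun a : Fin 12 => 3 • fccTab a) ∨ T = hcpTab) ∧ Function.Injective e ∧
      (∀ a : Fin 12, e a ≠ j ∧ dist (x j) (x (e a)) ≤ 1) ∧
      (∀ k : Fin N, k ≠ j → dist (x j) (x k) ≤ 1 → ∃ a : Fin 12, e a = k) ∧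
      (∀ a b : Fin 12, a ≠ b → (dist (x (e a)) (x (e b)) ≤ 1 ↔ sqNormInt (T a - T b) = 18)))
    {p t t' : Fin 12} (hp : e p = j') (htp : t ≠ p) (ht'p : t' ≠ p) (htt' : t ≠ t')
    (hadj : sqNormInt (T t - T p) = 18) (hadj' : sqNormInt (T t' - T p) = 18)
    (h36 : sqNormInt (T t - T t') = 36) :
    (131 : ℝ) / 100 ≤ dist (x (e t)) (x (e t')) ∧
      dist (x (e t)) (x (e t')) ^ 2 + ((131 : ℝ) / 100) ^ 2 ≤ 4 := by
  obtain ⟨hT, -, hnb, -, hiff⟩ := hc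
  have hfar : 1 < dist (x (e t)) (x (e t')) := by
    by_contra h
    have h18 := (hiff t t' htt').1 (not_lt.1 h)
    omega
  refine ⟨hgap _ _ (hnb t).2 (hnb t').2 hfar, ?_⟩
  obtain ⟨s, hsp, hsfar, hst, hst'⟩ := transferTable_36 hT p t t' hadj hadj' h36
  have hst_ne : s ≠ t := ne_of_sqNormInt_sub_pos hst (by norm_num)
  have hst'_ne : s ≠ t' := ne_of_sqNormInt_sub_pos hst' (by norm_num)
  have hm : (131 : ℝ) / 100 ≤ dist (x j') (x (e s)) := by
    have h1 : 1 < dist (x (e p)) (x (e s)) := by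
      by_contra h
      have h18 := (hiff p s hsp.symm).1 (not_lt.1 h)
      rw [sqNormInt_sub_comm] at h18
      omega
    rw [hp] at h1
    exact hgap _ _ hb (hnb s).2 h1
  have hd1 : dist (x (e t)) (x j') ≤ 1 := by rw [← hp]; exact (hiff t p htp).2 hadj
  have hd2 : dist (x j') (x (e t')) ≤ 1 := by
    rw [← hp, dist_comm]; exact (hiff t' p ht'p).2 hadj'
  have hd3 : dist (x (e t')) (x (e s)) ≤ 1 := by rw [dist_comm]; exact (hiff s t' hst'_ne).2 hst'
  have hd4 : dist (x (e s)) (x (e t)) ≤ 1 := (hiff s t hst_ne).2 hst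
  exact dist_sq_add_sq_le_four_of_quad _ _ _ _ hd1 hd2 hd3 hd4 hm

/-- **A third common neighbour transports.**  If some label `s` of the chart of `j` in the figure
of the pole `p` (`e p = j'`) is adjacent to the labels `a, a'`, then the corresponding site is a
common neighbour of `j, j'` bonded to `e a = e' b` and `e a' = e' b'`, so its label at `j'` lies
in the figure of the pole `q` (`e' q = j`) and is adjacent to `b, b'`. [folklore] -/
theorem third_transfer {N : ℕ} (x : Fin N → EuclideanSpace ℝ (Fin 3)) (j j' : Fin N)
    {T T' : Fin 12 → Fin 3 → ℤ} {e e' : Fin 12 → Fin N}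
    (hc : ((T = fun a : Fin 12 => 3 • fccTab a) ∨ T = hcpTab) ∧ Function.Injective e ∧
      (∀ a : Fin 12, e a ≠ j ∧ dist (x j) (x (e a)) ≤ 1) ∧
      (∀ k : Fin N, k ≠ j → dist (x j) (x k) ≤ 1 → ∃ a : Fin 12, e a = k) ∧
      (∀ a b : Fin 12, a ≠ b → (dist (x (e a)) (x (e b)) ≤ 1 ↔ sqNormInt (T a - T b) = 18)))
    (hc' : ((T' = fun a : Fin 12 => 3 • fccTab a) ∨ T' = hcpTab) ∧ Function.Injective e' ∧
      (∀ a : Fin 12, e' a ≠ j' ∧ dist (x j') (x (e' a)) ≤ 1) ∧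
      (∀ k : Fin N, k ≠ j' → dist (x j') (x k) ≤ 1 → ∃ a : Fin 12, e' a = k) ∧
      (∀ a b : Fin 12, a ≠ b → (dist (x (e' a)) (x (e' b)) ≤ 1 ↔ sqNormInt (T' a - T' b) = 18)))
    {p q a a' b b' : Fin 12} (hp : e p = j') (hq : e' q = j) (hab : e a = e' b)
    (hab' : e a' = e' b')
    (h : ∃ s : Fin 12, s ≠ p ∧ sqNormInt (T s - T p) = 18 ∧ sqNormInt (T s - T a) = 18 ∧
      sqNormInt (T s - T a') = 18) :
    ∃ s : Fin 12, s ≠ q ∧ sqNormInt (T' s - T' q) = 18 ∧ sqNormInt (T' s - T' b) = 18 ∧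
      sqNormInt (T' s - T' b') = 18 := by
  obtain ⟨-, hinj, hnb, -, hiff⟩ := hc
  obtain ⟨-, hinj', -, hsurj', hiff'⟩ := hc'
  obtain ⟨s, hsp, hs0, hsa, hsa'⟩ := h
  have hsa_ne : s ≠ a := ne_of_sqNormInt_sub_pos hsa (by norm_num)
  have hsa'_ne : s ≠ a' := ne_of_sqNormInt_sub_pos hsa' (by norm_num)
  have hl_j' : dist (x j') (x (e s)) ≤ 1 := by
    rw [← hp, dist_comm]; exact (hiff s p hsp).2 hs0
  have hl_ne : e s ≠ j' := by rw [← hp]; exact fun h' => hsp (hinj h')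
  obtain ⟨s', hs'⟩ := hsurj' (e s) hl_ne hl_j'
  have hne_q : s' ≠ q := by
    intro h'
    apply (hnb s).1
    rw [← hs', h', hq]
  have hne_b : s' ≠ b := by
    intro h'
    apply hsa_ne
    apply hinj
    rw [hab, ← h', hs']
  have hne_b' : s' ≠ b' := by
    intro h'
    apply hsa'_ne
    apply hinj
    rw [hab', ← h', hs']
  refine ⟨s', hne_q, ?_, ?_, ?_⟩
  · apply (hiff' s' q hne_q).1
    rw [hs', hq, dist_comm]
    exact (hnb s).2
  · apply (hiff' s' b hne_b).1
    rw [hs', ← hab]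
    exact (hiff s a hsa_ne).2 hsa
  · apply (hiff' s' b' hne_b').1
    rw [hs', ← hab']
    exact (hiff s a' hsa'_ne).2 hsa'

/-- **No `36/54` mismatch** (the geometric core, modulo `(H_lens)`).  If the labels of two
common neighbours `e a = e' b`, `e a' = e' b'` of the bonded pair `(j, j')` read squared
distance `36` at `j` and `54` at `j'`, then the `36`-pair is short (`bounds_of_sq36` at `j`), the
`54`-pair has a bonded partner forming a short `36`-pair with its other end (`transferTable_54`,
`bounds_of_sq36` at `j'`), and the five points `x j, x j'`, the bonded pair and the far point
form the configuration excluded by `(H_lens)`. [folklore] -/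
theorem transfer_key {N : ℕ} (x : Fin N → EuclideanSpace ℝ (Fin 3)) (j j' : Fin N)
    (hlens : ∀ x y a b c : EuclideanSpace ℝ (Fin 3), (55 : ℝ) / 57 ≤ dist x y → dist x y ≤ 1 →
      (55 : ℝ) / 57 ≤ dist x a → dist x a ≤ 1 → (55 : ℝ) / 57 ≤ dist x b → dist x b ≤ 1 →
      (55 : ℝ) / 57 ≤ dist x c → dist x c ≤ 1 → (55 : ℝ) / 57 ≤ dist y a → dist y a ≤ 1 →
      (55 : ℝ) / 57 ≤ dist y b → dist y b ≤ 1 → (55 : ℝ) / 57 ≤ dist y c → dist y c ≤ 1 →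
      (55 : ℝ) / 57 ≤ dist a b → dist a b ≤ 1 → (131 : ℝ) / 100 ≤ dist a c →
      dist a c ^ 2 + ((131 : ℝ) / 100) ^ 2 ≤ 4 → (131 : ℝ) / 100 ≤ dist b c →
      dist b c ^ 2 + ((131 : ℝ) / 100) ^ 2 ≤ 4 → False)
    (hlow : ∀ k k' : Fin N, dist (x j) (x k) ≤ 1 → dist (x j') (x k) ≤ 1 → k' ≠ k →
      (55 : ℝ) / 57 ≤ dist (x k) (x k'))
    (hgap : ∀ l l' : Fin N, dist (x j) (x l) ≤ 1 → dist (x j) (x l') ≤ 1 →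
      1 < dist (x l) (x l') → (131 : ℝ) / 100 ≤ dist (x l) (x l'))
    (hgap' : ∀ l l' : Fin N, dist (x j') (x l) ≤ 1 → dist (x j') (x l') ≤ 1 →
      1 < dist (x l) (x l') → (131 : ℝ) / 100 ≤ dist (x l) (x l'))
    (hjj' : j ≠ j') (hb : dist (x j) (x j') ≤ 1)
    {T T' : Fin 12 → Fin 3 → ℤ} {e e' : Fin 12 → Fin N}
    (hc : ((T = fun a : Fin 12 => 3 • fccTab a) ∨ T = hcpTab) ∧ Function.Injective e ∧
      (∀ a : Fin 12, e a ≠ j ∧ dist (x j) (x (e a)) ≤ 1) ∧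
      (∀ k : Fin N, k ≠ j → dist (x j) (x k) ≤ 1 → ∃ a : Fin 12, e a = k) ∧
      (∀ a b : Fin 12, a ≠ b → (dist (x (e a)) (x (e b)) ≤ 1 ↔ sqNormInt (T a - T b) = 18)))
    (hc' : ((T' = fun a : Fin 12 => 3 • fccTab a) ∨ T' = hcpTab) ∧ Function.Injective e' ∧
      (∀ a : Fin 12, e' a ≠ j' ∧ dist (x j') (x (e' a)) ≤ 1) ∧
      (∀ k : Fin N, k ≠ j' → dist (x j') (x k) ≤ 1 → ∃ a : Fin 12, e' a = k) ∧
      (∀ a b : Fin 12, a ≠ b → (dist (x (e' a)) (x (e' b)) ≤ 1 ↔ sqNormInt (T' a - T' b) = 18)))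
    {p q a a' b b' : Fin 12} (hp : e p = j') (hq : e' q = j) (hab : e a = e' b)
    (hab' : e a' = e' b') (haa' : a ≠ a')
    (h36 : sqNormInt (T a - T a') = 36) (h54 : sqNormInt (T' b - T' b') = 54) : False := by
  have hc0 := hc
  have hc0' := hc'
  obtain ⟨-, hinj, hnb, -, hiff⟩ := hc
  obtain ⟨hT', hinj', hnb', -, hiff'⟩ := hc'
  -- index bookkeeping
  have hap : a ≠ p := fun h => (hnb' b).1 (by rw [← hab, h, hp])
  have ha'p : a' ≠ p := fun h => (hnb' b').1 (by rw [← hab', h, hp])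
  have hbq : b ≠ q := fun h => (hnb a).1 (by rw [hab, h, hq])
  have hb'q : b' ≠ q := fun h => (hnb a').1 (by rw [hab', h, hq])
  have hbb' : b ≠ b' := fun h => haa' (hinj (by rw [hab, hab', h]))
  have hAp : sqNormInt (T a - T p) = 18 :=
    (hiff a p hap).1 (by rw [hp, hab, dist_comm]; exact (hnb' b).2)
  have hA'p : sqNormInt (T a' - T p) = 18 :=
    (hiff a' p ha'p).1 (by rw [hp, hab', dist_comm]; exact (hnb' b').2)
  have hBq : sqNormInt (T' b - T' q) = 18 :=
    (hiff' b q hbq).1 (by rw [hq, ← hab, dist_comm]; exact (hnb a).2)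
  have hB'q : sqNormInt (T' b' - T' q) = 18 :=
    (hiff' b' q hb'q).1 (by rw [hq, ← hab', dist_comm]; exact (hnb a').2)
  -- the `36`-pair at `j` is short
  obtain ⟨hfar1, hsq1⟩ := bounds_of_sq36 x j j' hgap hb hc0 hp hap ha'p haa' hAp hA'p h36
  -- the partner of the `54`-pair at `j'`
  obtain ⟨s, hsq, hs0, hcase⟩ := transferTable_54 hT' q b b' hbq hb'q hbb' hBq hB'q h54
  have hsj' : dist (x j') (x (e' s)) ≤ 1 := (hnb' s).2
  have hsj : dist (x j) (x (e' s)) ≤ 1 := by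
    rw [← hq, dist_comm]; exact (hiff' s q hsq).2 hs0
  have hs_ne_j : e' s ≠ j := by rw [← hq]; exact fun h => hsq (hinj' h)
  -- distance bounds for the lens lemma
  have h0 : dist (x j) (x j) ≤ 1 := by rw [dist_self]; norm_num
  have h0' : dist (x j') (x j') ≤ 1 := by rw [dist_self]; norm_num
  have hb' : dist (x j') (x j) ≤ 1 := by rw [dist_comm]; exact hb
  have dja : dist (x j) (x (e a)) ≤ 1 := (hnb a).2
  have dja' : dist (x j) (x (e a')) ≤ 1 := (hnb a').2
  have dj'a : dist (x j') (x (e a)) ≤ 1 := by rw [hab]; exact (hnb' b).2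
  have dj'a' : dist (x j') (x (e a')) ≤ 1 := by rw [hab']; exact (hnb' b').2
  have ljj' : (55 : ℝ) / 57 ≤ dist (x j) (x j') := hlow j j' h0 hb' hjj'.symm
  have lja : (55 : ℝ) / 57 ≤ dist (x j) (x (e a)) := hlow j (e a) h0 hb' (hnb a).1
  have lja' : (55 : ℝ) / 57 ≤ dist (x j) (x (e a')) := hlow j (e a') h0 hb' (hnb a').1
  have ljs : (55 : ℝ) / 57 ≤ dist (x j) (x (e' s)) := hlow j (e' s) h0 hb' hs_ne_j
  have lj'a : (55 : ℝ) / 57 ≤ dist (x j') (x (e a)) :=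
    hlow j' (e a) hb h0' (by rw [hab]; exact (hnb' b).1)
  have lj'a' : (55 : ℝ) / 57 ≤ dist (x j') (x (e a')) :=
    hlow j' (e a') hb h0' (by rw [hab']; exact (hnb' b').1)
  have lj's : (55 : ℝ) / 57 ≤ dist (x j') (x (e' s)) := hlow j' (e' s) hb h0' (hnb' s).1
  rcases hcase with ⟨hsb, h36'⟩ | ⟨hsb', h36'⟩
  · -- the partner is bonded to `e a`; `(partner, e a')` is a `36`-pair at `j'`
    have hsb_ne : s ≠ b := ne_of_sqNormInt_sub_pos hsb (by norm_num)
    have hsb'_ne : s ≠ b' := ne_of_sqNormInt_sub_pos h36' (by norm_num)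
    obtain ⟨hfar2, hsq2⟩ :=
      bounds_of_sq36 x j' j hgap' hb' hc0' hq hsq hb'q hsb'_ne hs0 hB'q h36'
    rw [← hab'] at hfar2 hsq2
    have dls : dist (x (e a)) (x (e' s)) ≤ 1 := by
      rw [hab, dist_comm]; exact (hiff' s b hsb_ne).2 hsb
    have lls : (55 : ℝ) / 57 ≤ dist (x (e a)) (x (e' s)) :=
      hlow (e a) (e' s) dja dj'a (by rw [hab]; exact fun h => hsb_ne (hinj' h))
    exact hlens (x j) (x j') (x (e a)) (x (e' s)) (x (e a')) ljj' hb lja dja ljs hsj lja' dja'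
      lj'a dj'a lj's hsj' lj'a' dj'a' lls dls hfar1 hsq1 hfar2 hsq2
  · -- the partner is bonded to `e a'`; `(partner, e a)` is a `36`-pair at `j'`
    have hsb'_ne : s ≠ b' := ne_of_sqNormInt_sub_pos hsb' (by norm_num)
    have hsb_ne : s ≠ b := ne_of_sqNormInt_sub_pos h36' (by norm_num)
    obtain ⟨hfar2, hsq2⟩ :=
      bounds_of_sq36 x j' j hgap' hb' hc0' hq hsq hbq hsb_ne hs0 hBq h36'
    rw [← hab] at hfar2 hsq2
    have dls : dist (x (e a')) (x (e' s)) ≤ 1 := by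
      rw [hab', dist_comm]; exact (hiff' s b' hsb'_ne).2 hsb'
    have lls : (55 : ℝ) / 57 ≤ dist (x (e a')) (x (e' s)) :=
      hlow (e a') (e' s) dja' dj'a' (by rw [hab']; exact fun h => hsb'_ne (hinj' h))
    rw [dist_comm] at hfar1 hsq1
    exact hlens (x j) (x j') (x (e a')) (x (e' s)) (x (e a)) ljj' hb lja' dja' ljs hsj lja dja
      lj'a' dj'a' lj's hsj' lj'a dj'a lls dls hfar1 hsq1 hfar2 hsq2

/-! ## The transfer lemma -/

/-- **Chart transfer** (helper form).  For two bonded sites `j ~ j'` carrying integer charts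
`(T, e)`, `(T', e')`, under `(H_lens)`, the Good separation around `j` and the local `131/100`
dichotomy at `j` and at `j'`: two common labelled sites `e a = e' b`, `e a' = e' b'` have the same
squared label distance in both charts. [folklore] -/
theorem transfer_of_zcharts' {N : ℕ} (x : Fin N → EuclideanSpace ℝ (Fin 3)) (j j' : Fin N)
    (hlens : ∀ x y a b c : EuclideanSpace ℝ (Fin 3), (55 : ℝ) / 57 ≤ dist x y → dist x y ≤ 1 →
      (55 : ℝ) / 57 ≤ dist x a → dist x a ≤ 1 → (55 : ℝ) / 57 ≤ dist x b → dist x b ≤ 1 →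
      (55 : ℝ) / 57 ≤ dist x c → dist x c ≤ 1 → (55 : ℝ) / 57 ≤ dist y a → dist y a ≤ 1 →
      (55 : ℝ) / 57 ≤ dist y b → dist y b ≤ 1 → (55 : ℝ) / 57 ≤ dist y c → dist y c ≤ 1 →
      (55 : ℝ) / 57 ≤ dist a b → dist a b ≤ 1 → (131 : ℝ) / 100 ≤ dist a c →
      dist a c ^ 2 + ((131 : ℝ) / 100) ^ 2 ≤ 4 → (131 : ℝ) / 100 ≤ dist b c →
      dist b c ^ 2 + ((131 : ℝ) / 100) ^ 2 ≤ 4 → False)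
    (hsep : ∀ j'' : Fin N, dist (x j) (x j'') ≤ 11 / 10 → ∀ k : Fin N, k ≠ j'' →
      (55 : ℝ) / 57 ≤ dist (x j'') (x k))
    (hgap : ∀ l l' : Fin N, dist (x j) (x l) ≤ 1 → dist (x j) (x l') ≤ 1 →
      1 < dist (x l) (x l') → (131 : ℝ) / 100 ≤ dist (x l) (x l'))
    (hgap' : ∀ l l' : Fin N, dist (x j') (x l) ≤ 1 → dist (x j') (x l') ≤ 1 →
      1 < dist (x l) (x l') → (131 : ℝ) / 100 ≤ dist (x l) (x l'))
    (hjj' : j ≠ j') (hb : dist (x j) (x j') ≤ 1)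
    {T T' : Fin 12 → Fin 3 → ℤ} {e e' : Fin 12 → Fin N}
    (hc : (((T = fun a : Fin 12 => 3 • fccTab a) ∨ T = hcpTab) ∧ Function.Injective e ∧
      (∀ a : Fin 12, e a ≠ j ∧ dist (x j) (x (e a)) ≤ 1) ∧
      (∀ k : Fin N, k ≠ j → dist (x j) (x k) ≤ 1 → ∃ a : Fin 12, e a = k) ∧
      (∀ a b : Fin 12, a ≠ b → (dist (x (e a)) (x (e b)) ≤ 1 ↔ sqNormInt (T a - T b) = 18))))
    (hc' : (((T' = fun a : Fin 12 => 3 • fccTab a) ∨ T' = hcpTab) ∧ Function.Injective e' ∧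
      (∀ a : Fin 12, e' a ≠ j' ∧ dist (x j') (x (e' a)) ≤ 1) ∧
      (∀ k : Fin N, k ≠ j' → dist (x j') (x k) ≤ 1 → ∃ a : Fin 12, e' a = k) ∧
      (∀ a b : Fin 12, a ≠ b → (dist (x (e' a)) (x (e' b)) ≤ 1 ↔ sqNormInt (T' a - T' b) = 18)))) :
    ∀ a a' b b' : Fin 12, e a = e' b → e a' = e' b' →
      sqNormInt (T a - T a') = sqNormInt (T' b - T' b') := by
  have hlow : ∀ k k' : Fin N, dist (x j) (x k) ≤ 1 → dist (x j') (x k) ≤ 1 → k' ≠ k →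
      (55 : ℝ) / 57 ≤ dist (x k) (x k') :=
    fun k k' hk _ hne => hsep k (hk.trans (by norm_num)) k' hne
  have hc0 := hc
  have hc0' := hc'
  obtain ⟨hT, hinj, hnb, hsurj, hiff⟩ := hc
  obtain ⟨hT', hinj', hnb', hsurj', hiff'⟩ := hc'
  obtain ⟨p, hp⟩ := hsurj j' hjj'.symm hb
  obtain ⟨q, hq⟩ := hsurj' j hjj' (by rw [dist_comm]; exact hb)
  intro a a' b b' hab hab'
  by_cases haa' : a = a'
  · subst haa'
    have hbb' : b = b' := hinj' (by rw [← hab, ← hab'])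
    subst hbb'
    simp only [sub_self]
  have hbb' : b ≠ b' := fun h => haa' (hinj (by rw [hab, hab', h]))
  have hap : a ≠ p := fun h => (hnb' b).1 (by rw [← hab, h, hp])
  have ha'p : a' ≠ p := fun h => (hnb' b').1 (by rw [← hab', h, hp])
  have hbq : b ≠ q := fun h => (hnb a).1 (by rw [hab, h, hq])
  have hb'q : b' ≠ q := fun h => (hnb a').1 (by rw [hab', h, hq])
  have hAp : sqNormInt (T a - T p) = 18 :=
    (hiff a p hap).1 (by rw [hp, hab, dist_comm]; exact (hnb' b).2)
  have hA'p : sqNormInt (T a' - T p) = 18 :=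
    (hiff a' p ha'p).1 (by rw [hp, hab', dist_comm]; exact (hnb' b').2)
  have hBq : sqNormInt (T' b - T' q) = 18 :=
    (hiff' b q hbq).1 (by rw [hq, ← hab, dist_comm]; exact (hnb a).2)
  have hB'q : sqNormInt (T' b' - T' q) = 18 :=
    (hiff' b' q hb'q).1 (by rw [hq, ← hab', dist_comm]; exact (hnb a').2)
  have hfig := transferTable_figure hT p a a' hap ha'p haa' hAp hA'p
  have hfig' := transferTable_figure hT' q b b' hbq hb'q hbb' hBq hB'q
  have h18 : sqNormInt (T a - T a') = 18 ↔ sqNormInt (T' b - T' b') = 18 := by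
    rw [← hiff a a' haa', ← hiff' b b' hbb', hab, hab']
  have h48 : sqNormInt (T a - T a') = 48 ↔ sqNormInt (T' b - T' b') = 48 := by
    rw [transferTable_48 hT p a a' hap ha'p haa' hAp hA'p,
      transferTable_48 hT' q b b' hbq hb'q hbb' hBq hB'q]
    exact ⟨third_transfer x j j' hc0 hc0' hp hq hab hab',
      third_transfer x j' j hc0' hc0 hq hp hab.symm hab'.symm⟩
  have k1 : ¬ (sqNormInt (T a - T a') = 36 ∧ sqNormInt (T' b - T' b') = 54) := fun h =>
    transfer_key x j j' hlens hlow hgap hgap' hjj' hb hc0 hc0' hp hq hab hab' haa' h.1 h.2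
  have k2 : ¬ (sqNormInt (T' b - T' b') = 36 ∧ sqNormInt (T a - T a') = 54) := fun h =>
    transfer_key x j' j hlens (fun k k' h1 h2 hne => hlow k k' h2 h1 hne) hgap' hgap hjj'.symm
      (by rw [dist_comm]; exact hb) hc0' hc0 hq hp hab.symm hab'.symm hbb' h.1 h.2
  generalize sqNormInt (T a - T a') = A at hfig h18 h48 k1 k2 ⊢
  generalize sqNormInt (T' b - T' b') = B at hfig' h18 h48 k1 k2 ⊢
  omega

/-- **Chart transfer** (anchor of this file; the combinatorial replacement of the tree's
`sqNormInt_transfer`).  Under the five-point lens lemma `(H_lens)`: for two bonded sites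
`j ~ j'` of a configuration, with the Good separation around `j`, the local `131/100` dichotomy
at `j` and at `j'`, and integer charts `(T, e)` at `j`, `(T', e')` at `j'` (`T = 3 • fccTab` or
`hcpTab`, `e` injective onto the neighbours, bonds ↔ label pairs at squared distance `18`), any
two common labelled sites `e a = e' b`, `e a' = e' b'` have the same squared label distance in
both charts.  (Pairs involving the centres are bonds, read `18` on both sides trivially; so the
label classes of the whole common closed star agree.) [folklore] -/
theorem transfer_of_zcharts :
    ∀ (N : ℕ) (x : Fin N → EuclideanSpace ℝ (Fin 3)) (j j' : Fin N), (∀ x y a b c :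
    EuclideanSpace ℝ (Fin 3), (55 : ℝ) / 57 ≤ dist x y → dist x y ≤ 1 → (55 : ℝ) / 57 ≤ dist x a
    → dist x a ≤ 1 → (55 : ℝ) / 57 ≤ dist x b → dist x b ≤ 1 → (55 : ℝ) / 57 ≤ dist x c → dist x
    c ≤ 1 → (55 : ℝ) / 57 ≤ dist y a → dist y a ≤ 1 → (55 : ℝ) / 57 ≤ dist y b → dist y b ≤ 1 →
    (55 : ℝ) / 57 ≤ dist y c → dist y c ≤ 1 → (55 : ℝ) / 57 ≤ dist a b → dist a b ≤ 1 → (131 :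
    ℝ) / 100 ≤ dist a c → dist a c ^ 2 + ((131 : ℝ) / 100) ^ 2 ≤ 4 → (131 : ℝ) / 100 ≤ dist b c
    → dist b c ^ 2 + ((131 : ℝ) / 100) ^ 2 ≤ 4 → False) → (∀ j'' : Fin N, dist (x j) (x j'') ≤
    11 / 10 → ∀ k : Fin N, k ≠ j'' → (55 : ℝ) / 57 ≤ dist (x j'') (x k)) → (∀ l l' : Fin N, dist
    (x j) (x l) ≤ 1 → dist (x j) (x l') ≤ 1 → 1 < dist (x l) (x l') → (131 : ℝ) / 100 ≤ dist (x
    l) (x l')) → (∀ l l' : Fin N, dist (x j') (x l) ≤ 1 → dist (x j') (x l') ≤ 1 → 1 < dist (x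
    l) (x l') → (131 : ℝ) / 100 ≤ dist (x l) (x l')) → j ≠ j' → dist (x j) (x j') ≤ 1 → ∀ (T T'
    : Fin 12 → Fin 3 → ℤ) (e e' : Fin 12 → Fin N), ((((T = fun a : Fin 12 => 3 •
    Literature.Geometry.DiscreteGeometry.fccTab a) ∨ T =
    Literature.Geometry.DiscreteGeometry.hcpTab) ∧ Function.Injective e ∧ (∀ a : Fin 12, e a ≠ j
    ∧ dist (x j) (x (e a)) ≤ 1) ∧ (∀ k : Fin N, k ≠ j → dist (x j) (x k) ≤ 1 → ∃ a : Fin 12, e a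
    = k) ∧ (∀ a b : Fin 12, a ≠ b → (dist (x (e a)) (x (e b)) ≤ 1 ↔
    Literature.Geometry.DiscreteGeometry.sqNormInt (T a - T b) = 18)))) → ((((T' = fun a : Fin
    12 => 3 • Literature.Geometry.DiscreteGeometry.fccTab a) ∨ T' =
    Literature.Geometry.DiscreteGeometry.hcpTab) ∧ Function.Injective e' ∧ (∀ a : Fin 12, e' a ≠
    j' ∧ dist (x j') (x (e' a)) ≤ 1) ∧ (∀ k : Fin N, k ≠ j' → dist (x j') (x k) ≤ 1 → ∃ a : Fin
    12, e' a = k) ∧ (∀ a b : Fin 12, a ≠ b → (dist (x (e' a)) (x (e' b)) ≤ 1 ↔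
    Literature.Geometry.DiscreteGeometry.sqNormInt (T' a - T' b) = 18)))) → ∀ a a' b b' : Fin
    12, e a = e' b → e a' = e' b' → Literature.Geometry.DiscreteGeometry.sqNormInt (T a - T a')
    = Literature.Geometry.DiscreteGeometry.sqNormInt (T' b - T' b') :=
  fun _ x j j' hlens hsep hgap hgap' hjj' hb _ _ _ _ hc hc' =>
    transfer_of_zcharts' x j j' hlens hsep hgap hgap' hjj' hb hc hc'

end Summit.AtomisticToContinuum.Crystallization.Theorems.SquareWellLayerCakeGapTwelveToBarlow
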